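import Summits.BirchSwinnertonDyer.BirchSwinnertonDyer.Theorems.ErratumRoadFiveNonSurjCornerTwinLeafSub
import Summits.BirchSwinnertonDyer.BirchSwinnertonDyer.Theorems.ErratumRoadFiveNonSurjCornerTwinKatoEngine

/-!
# Route `ErratumRoadFive` (rung K2a), crux 6 `NonSurjCorner` (item 19065): the corner's TWIN summand is the
# KATO HALF only — the rank-`0` twin's UPPER bound from x11c's typed divisibility `X11b.MultDivisibilityAt`
# (engine `ErratumRoadFiveNonSurjCornerTwinKatoEngine.lean`); the twin's lower half is crux 19064 BY NAME
# (cell `bsd-stepL`, seat `bsd-stepL-corner-p1` g4; `--supports stmt-BirchSwinnertonDyer-19065`)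

Item 19065 is `Typed.MissingPPartAt W p` on the (T4′) corner of class X11b (`ρ̄_{E,p}` NOT onto, `p ∈ {5,7}`,
`p ∣ ord_p Δ_min`, no (ram) witness). State of record after g3 (`…TwinLeaf.lean`, p442962):
`NonSurjCorner ⟸ pubs + Zₚᶜ + Jₚᶜ + Mazur's main conjecture (X2.MazurMainConjectureAt) on the NON-SURJECTIVE
X11a leaf` — the last binder supplying BOTH Miller halves of the rank-`0` Heegner twin `E^{d_K}`.

THIS FILE observes that the corner consumes the two twin halves SEPARATELY and that only ONE of them is an
un-named object: the twin's LOWER half (`ord_p #Ш_an ≤ ord_p #Ш`, the Skinner–Urban ∕ Greenberg–Vatsal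
direction) is crux 19064 `X11aLowerHalf` BY NAME (rung K6 ∕ B3's object, stated for every X11a pair, any
image), while the corner's own lower half needs only the twin's UPPER half (the KATO direction: g0's `hT`,
g2's §2) — supplied here from x11c's typed missing input `X11b.MultDivisibilityAt Wd p` by the engine file's
`missingUpperBoundAt_of_classX11a_of_multDivisibilityAt` (Stein–Wuthrich Thm. 6.1 in rank `0`, the
interpolation ∕ Greenberg–Stevens, GZK, modularity; no image hypothesis):

* **`erratumRoadFive_nonSurjCorner_of_certificates_of_lowerX11a_of_twinMultDivisibility : pubs →
  EulerHalfOffLocus → X11aLowerHalf → Zₚᶜ → (∀ X11a Wd, ¬Surj, p ∈ {5,7}, p ∣ ord_pΔ: X11b.MultDivisibilityAt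
  Wd p) → NonSurjCorner`** — g2's `erratumRoadFive_nonSurjCorner_of_certificates_of_twinUpper` with its
  binder `hT` DISCHARGED.
* **`erratumRoadFive_nonSurjCorner_of_refinedKolyvagin_of_lowerX11a_of_twinMultDivisibility : pubs →
  X11aLowerHalf → Zₚᶜ → Jₚᶜ → (∀ leaf twins, X11b.MultDivisibilityAt Wd p) → NonSurjCorner`** — g3's §2 with
  the twin's main-conjecture half taken from crux 19064 by name and its Euler-system half from the engine; no
  `EulerHalfOffLocus`.
* `erratumRoadFive_nonSurjCorner_of_refinedKolyvagin_of_lowerX11a_of_twinLeafMazurMC` — consistency: g3's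
  leaf input `hMC` still suffices (it implies `hdiv`, §2).

READING. Beyond the route's own cruxes 19062 ∕ 19064 and the refined Kolyvagin inputs Zₚᶜ ∕ Jₚᶜ on corner
frames, the corner's residual is the KATO HALF of the twin only: `MultDivisibilityAt` at a pair follows from
Kato's divisibility in `Λ[1/p]` plus `μ(char_Λ X(E^{d}/ℚ_∞)) = 0` — the multiplicative twin of rung K6's
crux `MuTransfer` (`Rank1Residual.KatoMuTransfer`, typed at GOOD ordinary `p`) composed with the per-pair
certificate `X11a.MuAnZeroAt`; the λ-part ∕ Skinner–Urban side of the twin is NOT asked beyond 19064.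

HONEST FRAMING. Zₚᶜ, Jₚᶜ and the twin divisibility are hypothesis SHAPES ∕ a typed missing input (no new
`def`, no named fact minted); nothing here proves them; item 19065 does NOT close; no census word moves; BSD
is not proved by any of this. Flag `Cha05-Rmk25-structure` rides on every theorem here. CONDITIONAL throughout.

References: [Kato2004Asterisque] Thm. 17.4; [Wuthrich2014] Thm. 3, Prop. 21 (pp. 383, 400); [SteinWuthrich2013]
Thm. 6.1 (p. 20); [Cha2005] Thm. 21, Rmk. 25; [MatarNekovar2019] Thm. 0.3 ∕ 0.7, §0.9–0.11; [WZhang2014] Thm. 1.1;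
[Jetchev2008] Conj. 1.3; [JetchevSkinnerWan2017] §7.4; [Miller2011LMS] Def. 1.1; tree: g0–g3's
`Theorems/ErratumRoadFiveNonSurjCorner*.lean`, `X11b/MultiplicativeDivisibility.lean` (x11c gen 5).
-/

noncomputable section

open scoped Classical NumberField MatrixGroups ModularForm

namespace Summit.BirchSwinnertonDyer.Rank1Residual.X11b

open CongruenceSubgroup WeierstrassCurve NumberField IsDedekindDomain Field
  Literature.NumberTheory.EllipticCurves
  Literature.NumberTheory.EllipticCurves.ModularForms
  Literature.NumberTheory.EllipticCurves.Rank1Residual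
  Literature.NumberTheory.EllipticCurves.Rank1Residual.Typed
  Literature.NumberTheory.EllipticCurves.Wuthrich2014
  Literature.NumberTheory.EllipticCurves.SteinWuthrich2013
  Literature.NumberTheory.EllipticCurves.GreenbergVatsal2000
  Literature.NumberTheory.EllipticCurves.EmertonPollackWeston2006
  Literature.NumberTheory.QuadraticFields.Quadratic
  Summit.BirchSwinnertonDyer.Rank1Residual
  Summit.BirchSwinnertonDyer.Rank1Residual.RankZeroHeightFree
  Summit.BirchSwinnertonDyer.Rank1Residual.X11b.Three.Koly


/-! ### §1 g3's leaf input (Mazur's main conjecture at the twin) implies the typed divisibility -/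

/-- **Mazur's main conjecture at the pair ⟹ x11c's typed divisibility at the pair** (the generator times the
unit is the required element of `char_Λ X`; the μ-clause and the equality are forgotten). So every consumer
of this file is implied by the corresponding consumer of `…TwinLeaf.lean`. [cite: Skinner2016PacificMC, Thm. A (§1) (shape only)]
[cite: Wuthrich2014, Thm. 3 (p. 383) (shape only)] -/
theorem multDivisibilityAt_of_mazurMainConjectureAt (W : WeierstrassCurve ℚ) [W.IsElliptic]
    [W.IsGloballyMinimal] (p : ℕ) [Fact p.Prime] (hMC : X2.MazurMainConjectureAt W p) :
    MultDivisibilityAt W p := by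
  intro κ γ N _ f hκ hγ hγ' hf D ϖ _ hϖ
  obtain ⟨hX, g, hchar, hsp, hnsp⟩ := hMC κ γ hκ hγ hγ' f hf D ϖ hϖ
  have hmem : ∀ w : (IwasawaAlgebra p)ˣ, g * (w : IwasawaAlgebra p) ∈ D.charIdeal := by
    intro w
    rw [hchar]
    exact Ideal.mul_mem_right _ _ (Ideal.mem_span_singleton_self g)
  refine ⟨hX, fun hns L hL => ?_, fun hs L hL => ?_⟩
  · obtain ⟨w, hw⟩ := hnsp hns L hL
    exact ⟨g * (w : IwasawaAlgebra p), hmem w, hw⟩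
  · obtain ⟨w, hw⟩ := hsp hs L hL
    refine ⟨g * (w : IwasawaAlgebra p), hmem w, ?_⟩
    rw [← mul_assoc]
    exact hw

/-! ### §2 The corner: the twin summand is the typed divisibility on the non-surjective X11a leaf -/

/-- **`NonSurjCorner` modulo print + EulerHalfOffLocus (19062) + X11aLowerHalf (19064) + Zₚᶜ + the TYPED
DIVISIBILITY on the twins** — g2's `erratumRoadFive_nonSurjCorner_of_certificates_of_twinUpper` with its binder
`hT` (the Euler-system half of the rank-`0` twin corner — no print: Kato 17.4 (3) needs `SL₂(ℤ_p) ⊆ im ρ`,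
Wuthrich Prop. 21's `C` is supported at such `p`) DISCHARGED by §1 from x11c's missing input
`X11b.MultDivisibilityAt Wd p` at the X11a pairs `Wd` with `¬Surj`, `p ∈ {5,7}`, `p ∣ ord_p Δ_min(Wd)` (the
non-surjective leaf; the Friedberg–Hoffstein twin of a corner pair IS such a pair, `not_surj_twist_model`).
PUBLISHED binders as there + Stein–Wuthrich Thm. 6.1 (`hJs`/`hJn`), `hpar`, Greenberg–Stevens (`hGS`).
CONDITIONAL on `h₂`, `h₄`, `hZ`, `hdiv`; does NOT close item 19065; nothing booked.
[cite: Cha2005, Rmk. 25 (p. 175)] [cite: MatarNekovar2019, Thm. 0.3, §0.9, §0.11 (pp. 456–457)]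
[cite: WZhang2014, Thm. 1.1 and Rem. 5 (shape of Zₚᶜ)] [cite: SteinWuthrich2013, Thm. 6.1 (p. 20)]
[cite: Wuthrich2014, Thm. 3 (p. 383), Prop. 21 (p. 400)] [cite: JetchevSkinnerWan2017, §7.4.1–7.4.2 (pp. 30–31)]
[cite: Miller2011LMS, Def. 1.1] -/
theorem erratumRoadFive_nonSurjCorner_of_certificates_of_lowerX11a_of_twinMultDivisibility
    (hGZ : ∀ (N : ℕ) [NeZero N] (W : WeierstrassCurve ℚ) (K : Type) [Field K] [NumberField K],
      gross_zagier N W K)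
    (hKo : ∀ (N : ℕ) [NeZero N] (W : WeierstrassCurve ℚ) (K : Type) [Field K] [NumberField K],
      kolyvagin N W K)
    (hWu : sha_dvd_analyticSha)
    (hMN : ∀ (N : ℕ) [NeZero N] (W : WeierstrassCurve ℚ) (K : Type) [Field K] [NumberField K],
      MatarNekovar2019.thm03_padicValNat_card_sha_le_of_irreducible N W K)
    (hGZK : rank_eq_analyticRank_of_analyticRank_le_one) (hmod : hasEntireLFunction_rat)
    (hnf : exists_isNewformOf) (hpar : nonempty_modularParametrizationData)
    (hFHs : friedbergHoffstein_exists_heegnerField_split_twist_ne_zero)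
    (hMaz : mazur_not_dvd_maninConstant_of_odd)
    (hrec : ∀ (N : ℕ) [NeZero N] (W : WeierstrassCurve ℚ) (K : Type) [Field K] [NumberField K],
      heegnerPointOfConductor_one_galoisConj N W K)
    (hD36 : ∀ (N : ℕ) [NeZero N] (W : WeierstrassCurve ℚ) (K : Type) [Field K] [NumberField K],
      phi_heegnerTau_mem_singularModuliField N W K)
    (hJs : thm61_splitMultiplicative) (hJn : thm61_nonsplitMultiplicative)
    (hGS : ∀ (W : WeierstrassCurve ℚ) [W.IsElliptic] [W.IsGloballyMinimal] (p : ℕ) [Fact p.Prime],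
      greenberg_stevens (W := W) (p := p))
    (hChaL : Cha2005.rmk25_pow_dvd_card_sha_primary_of_certificate)
    (h₂ : Summit.BirchSwinnertonDyer.BirchSwinnertonDyer.Theses.ErratumRoadFive.EulerHalfOffLocus)
    (h₄ : Summit.BirchSwinnertonDyer.BirchSwinnertonDyer.Theses.ErratumRoadFive.X11aLowerHalf)
    -- Zₚᶜ: certificates on corner frames (`M_∞ ≤ t`)
    (hZ : ∀ (W : WeierstrassCurve ℚ) [W.IsElliptic] [W.IsGloballyMinimal] (p : ℕ) [Fact p.Prime]
      (N : ℕ) [NeZero N] (K : Type) [Field K] [NumberField K]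
      (Dt : ModularParametrizationData W N) (β : ℤ) (ι : K →+* ℂ),
      ClassX11b W p → ¬ Surj W p → (p = 5 ∨ p = 7) → p ∣ padicValInt p W.minimalDiscriminantInt →
      ¬ Ram W p → W.conductorNorm ℤ = N → IsImaginaryQuadratic K →
      4 < (NumberField.discr K).natAbs → SatisfiesHeegnerHypothesis N K →
      SatisfiesHeegnerHypothesis p K → (4 * (N : ℤ)) ∣ β ^ 2 - NumberField.discr K → ¬ (p : ℤ) ∣ Dt.c →
      ∃ M : ℕ, M ≤ padicValNat p W.tamagawaProduct ∧ CertificateAt Dt β ι p M)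
    -- the typed divisibility on the NON-SURJECTIVE X11a leaf at p ∈ {5,7} (x11c's missing input, by name)
    (hdiv : ∀ (Wd : WeierstrassCurve ℚ) [Wd.IsElliptic] [Wd.IsGloballyMinimal] (p : ℕ) [Fact p.Prime],
      ClassX11a Wd p → ¬ Surj Wd p → (p = 5 ∨ p = 7) →
      p ∣ padicValInt p Wd.minimalDiscriminantInt → MultDivisibilityAt Wd p) :
    Summit.BirchSwinnertonDyer.BirchSwinnertonDyer.Theses.ErratumRoadFive.NonSurjCorner :=
  erratumRoadFive_nonSurjCorner_of_certificates_of_twinUpper hGZ hKo hWu hMN hGZK hmod hnf hFHs hMaz hrec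
    hD36 hChaL h₂ h₄ hZ
    (fun Wd _ _ p _ hXa hnsd h57 hvd ↦
      missingUpperBoundAt_of_classX11a_of_multDivisibilityAt hJs hJn hGZK hmod hpar Wd p (hGS Wd p) hXa
        (hdiv Wd p hXa hnsd h57 hvd))

/-- **`NonSurjCorner` modulo print + X11aLowerHalf (19064) + Zₚᶜ + Jₚᶜ + the TYPED DIVISIBILITY on the twins —
no `EulerHalfOffLocus`.** g3's `erratumRoadFive_nonSurjCorner_of_refinedKolyvagin_of_twinLeafMazurMC` with its
leaf input (Mazur's main conjecture on the non-surjective X11a leaf — BOTH twin halves) SPLIT: the twin's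
main-conjecture half is crux 19064 `X11aLowerHalf` BY NAME (used only at the leaf twins), its Euler-system
half comes from x11c's typed divisibility `X11b.MultDivisibilityAt` by §1. Same proof: the corner's upper
half by `missingUpperBoundAt_corner_of_jetchevDivisibility_of_twinLeafLower` (Jₚᶜ + twin lower), its lower
half by g0's `missingLowerBoundAt_of_classX11b_of_indexLowerBoundNoSurj_of_upperTwist` fed with g2's
`indexLowerBoundAt_corner_of_certificates` (Zₚᶜ) and the twin upper half (§1; the twin is an X11a leaf pair:
`classX11a_twist_of_not_ram`, `not_surj_twist_model`, `padicValInt_minimalDiscriminantInt_twist_eq`).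
CONDITIONAL on `h₄`, `hZ`, `hJ`, `hdiv`; does NOT close item 19065; nothing booked.
[cite: Cha2005, Thm. 21 and Rmk. 25 (pp. 173–175)] [cite: MatarNekovar2019, Thm. 0.7, §0.9, §0.11 (pp. 456–457)]
[cite: McCallumLMS1991, §5 Cor. 5.6 (p. 310)] [cite: WZhang2014, Thm. 1.1 and Rem. 5 (shape of Zₚᶜ)]
[cite: Jetchev2008, Conj. 1.3 (shape of Jₚᶜ)] [cite: SteinWuthrich2013, Thm. 6.1 (p. 20)]
[cite: Wuthrich2014, Thm. 3 (p. 383) (shape of the divisibility)] [cite: JetchevSkinnerWan2017, §7.4.1–7.4.2 (pp. 30–31)]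
[cite: Miller2011LMS, Def. 1.1] [cite: SilvermanAEC2009, X.5 Cor. 5.4] -/
theorem erratumRoadFive_nonSurjCorner_of_refinedKolyvagin_of_lowerX11a_of_twinMultDivisibility
    (hGZ : ∀ (N : ℕ) [NeZero N] (W : WeierstrassCurve ℚ) (K : Type) [Field K] [NumberField K],
      gross_zagier N W K)
    (hKo : ∀ (N : ℕ) [NeZero N] (W : WeierstrassCurve ℚ) (K : Type) [Field K] [NumberField K],
      kolyvagin N W K)
    (hWu : sha_dvd_analyticSha)
    (hGZK : rank_eq_analyticRank_of_analyticRank_le_one) (hmod : hasEntireLFunction_rat)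
    (hnf : exists_isNewformOf) (hpar : nonempty_modularParametrizationData)
    (hFHs : friedbergHoffstein_exists_heegnerField_split_twist_ne_zero)
    (hMaz : mazur_not_dvd_maninConstant_of_odd)
    (hrec : ∀ (N : ℕ) [NeZero N] (W : WeierstrassCurve ℚ) (K : Type) [Field K] [NumberField K],
      heegnerPointOfConductor_one_galoisConj N W K)
    (hD36 : ∀ (N : ℕ) [NeZero N] (W : WeierstrassCurve ℚ) (K : Type) [Field K] [NumberField K],
      phi_heegnerTau_mem_singularModuliField N W K)
    (hJs : thm61_splitMultiplicative) (hJn : thm61_nonsplitMultiplicative)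
    (hGS : ∀ (W : WeierstrassCurve ℚ) [W.IsElliptic] [W.IsGloballyMinimal] (p : ℕ) [Fact p.Prime],
      greenberg_stevens (W := W) (p := p))
    (hChaL : Cha2005.rmk25_pow_dvd_card_sha_primary_of_certificate)
    (hChaU : Cha2005.rmk25_padicValNat_card_sha_primary_add_le_of_globalDivisibility)
    (h₄ : Summit.BirchSwinnertonDyer.BirchSwinnertonDyer.Theses.ErratumRoadFive.X11aLowerHalf)
    -- Zₚᶜ: certificates on corner frames (`M_∞ ≤ t`)
    (hZ : ∀ (W : WeierstrassCurve ℚ) [W.IsElliptic] [W.IsGloballyMinimal] (p : ℕ) [Fact p.Prime]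
      (N : ℕ) [NeZero N] (K : Type) [Field K] [NumberField K]
      (Dt : ModularParametrizationData W N) (β : ℤ) (ι : K →+* ℂ),
      ClassX11b W p → ¬ Surj W p → (p = 5 ∨ p = 7) → p ∣ padicValInt p W.minimalDiscriminantInt →
      ¬ Ram W p → W.conductorNorm ℤ = N → IsImaginaryQuadratic K →
      4 < (NumberField.discr K).natAbs → SatisfiesHeegnerHypothesis N K →
      SatisfiesHeegnerHypothesis p K → (4 * (N : ℤ)) ∣ β ^ 2 - NumberField.discr K → ¬ (p : ℤ) ∣ Dt.c →
      ∃ M : ℕ, M ≤ padicValNat p W.tamagawaProduct ∧ CertificateAt Dt β ι p M)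
    -- Jₚᶜ: the Jetchev direction on corner frames (`M_∞ ≥ t`)
    (hJ : ∀ (W : WeierstrassCurve ℚ) [W.IsElliptic] [W.IsGloballyMinimal] [NeZero (W.conductorNorm ℤ)]
      (p : ℕ) [Fact p.Prime] (K : Type) [Field K] [NumberField K]
      (Dt : ModularParametrizationData W (W.conductorNorm ℤ)) (β : ℤ) (ι : K →+* ℂ),
      ClassX11b W p → ¬ Surj W p → (p = 5 ∨ p = 7) → p ∣ padicValInt p W.minimalDiscriminantInt →
      ¬ Ram W p → IsImaginaryQuadratic K → 4 < (NumberField.discr K).natAbs →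
      SatisfiesHeegnerHypothesis (W.conductorNorm ℤ) K → SatisfiesHeegnerHypothesis p K →
      (4 * (W.conductorNorm ℤ : ℤ)) ∣ β ^ 2 - NumberField.discr K → ¬ (p : ℤ) ∣ Dt.c →
      ∀ (s : ℕ), s ≤ padicValNat p W.tamagawaProduct →
        ∀ (n : ℕ) (d : KolyvaginHeegnerData Dt β ι n), Squarefree n →
          (∀ ℓ ∈ n.primeFactors, Zhang2014.IsKolyvaginPrime (W.conductorNorm ℤ) W K p ℓ ∧
            s ≤ Zhang2014.kolyvaginIndex W p ℓ) → PDiv d p s)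
    -- the typed divisibility on the NON-SURJECTIVE X11a leaf at p ∈ {5,7} (x11c's missing input, by name)
    (hdiv : ∀ (Wd : WeierstrassCurve ℚ) [Wd.IsElliptic] [Wd.IsGloballyMinimal] (p : ℕ) [Fact p.Prime],
      ClassX11a Wd p → ¬ Surj Wd p → (p = 5 ∨ p = 7) →
      p ∣ padicValInt p Wd.minimalDiscriminantInt → MultDivisibilityAt Wd p) :
    Summit.BirchSwinnertonDyer.BirchSwinnertonDyer.Theses.ErratumRoadFive.NonSurjCorner := by
  intro W _ _ p _ hX hns h57 hv hnr
  have hp5 : 5 ≤ p := by rcases h57 with h | h <;> omega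
  -- the Euler-system half of every non-surjective-leaf twin at this p, from the typed divisibility (§1)
  have hleafU : ∀ (Wd : WeierstrassCurve ℚ) [Wd.IsElliptic] [Wd.IsGloballyMinimal],
      ClassX11a Wd p → ¬ Surj Wd p → p ∣ padicValInt p Wd.minimalDiscriminantInt →
      Typed.MissingUpperBoundAt Wd p := fun Wd _ _ hXa hnsd hvd ↦
    missingUpperBoundAt_of_classX11a_of_multDivisibilityAt hJs hJn hGZK hmod hpar Wd p (hGS Wd p) hXa
      (hdiv Wd p hXa hnsd h57 hvd)
  refine Typed.missingPPartAt_of_lower_of_upper W p ?_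
    (missingUpperBoundAt_corner_of_jetchevDivisibility_of_twinLeafLower hGZ hKo hGZK hmod hnf hFHs hMaz
      hrec hD36 hChaU W p hX hns h57 hv hnr
      (fun Wd _ _ hXa _ _ ↦ h₄ Wd p hXa)
      (fun K _ _ Dt β ι hK hdisc hHN hHp hβ hc ↦
        hJ W p K Dt β ι hX hns h57 hv hnr hK hdisc hHN hHp hβ hc))
  refine missingLowerBoundAt_of_classX11b_of_indexLowerBoundNoSurj_of_upperTwist hGZ hKo hWu hGZK
    hmod hnf hFHs hMaz W p hX hp5
    (fun N _ K _ _ Dt H ι P hN hK hdisc hHN hHp hLt hP hc hPinf ↦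
      indexLowerBoundAt_corner_of_certificates hGZ hKo hmod hrec hD36 hChaL W p N K Dt H ι P hX hp5 hN
        hK hdisc hHN hLt hP hPinf (hZ W p N K Dt H.β ι hX hns h57 hv hnr hN hK hdisc hHN hHp H.dvd_sq_sub hc))
    ?_
  intro K _ _ Wd _ _ Cd hK hHN hLt hWd hnsd
  have hD0 : (NumberField.discr K : ℚ) ≠ 0 := by exact_mod_cast NumberField.discr_ne_zero K
  haveI : (W.quadraticTwist (NumberField.discr K : ℚ)).IsElliptic := W.isElliptic_quadraticTwist hD0
  have hrd : Wd.analyticRank = 0 := by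
    rw [← hWd, analyticRank_smul]
    exact analyticRank_eq_zero_of_entireLFunction_one_ne_zero _ hLt
  have hXa : ClassX11a Wd p := classX11a_twist_of_not_ram W p hX hnr K hK hHN Cd hWd hrd
  have hpN : p ∣ W.conductorNorm ℤ := dvd_conductorNorm_of_mult hX.2.2.1
  have hsq := isSquare_discr_padic_of_heegner K hK hHN p hpN
  have hvd : p ∣ padicValInt p Wd.minimalDiscriminantInt := by
    rw [padicValInt_minimalDiscriminantInt_twist_eq W p hD0 hsq Cd hWd]
    exact hv
  exact hleafU Wd hXa hnsd hvd

/-- **Consistency with g3: Mazur's main conjecture on the leaf twins still suffices** (through §2: it implies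
the typed divisibility), now with the twin's lower half read from crux 19064. A corollary recording that the
new binder `hdiv` is IMPLIED by g3's `hMC`; nothing booked. [cite: Skinner2016PacificMC, Thm. A (§1) (shape only)]
[cite: Miller2011LMS, Def. 1.1] -/
theorem erratumRoadFive_nonSurjCorner_of_refinedKolyvagin_of_lowerX11a_of_twinLeafMazurMC
    (hGZ : ∀ (N : ℕ) [NeZero N] (W : WeierstrassCurve ℚ) (K : Type) [Field K] [NumberField K],
      gross_zagier N W K)
    (hKo : ∀ (N : ℕ) [NeZero N] (W : WeierstrassCurve ℚ) (K : Type) [Field K] [NumberField K],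
      kolyvagin N W K)
    (hWu : sha_dvd_analyticSha)
    (hGZK : rank_eq_analyticRank_of_analyticRank_le_one) (hmod : hasEntireLFunction_rat)
    (hnf : exists_isNewformOf) (hpar : nonempty_modularParametrizationData)
    (hFHs : friedbergHoffstein_exists_heegnerField_split_twist_ne_zero)
    (hMaz : mazur_not_dvd_maninConstant_of_odd)
    (hrec : ∀ (N : ℕ) [NeZero N] (W : WeierstrassCurve ℚ) (K : Type) [Field K] [NumberField K],
      heegnerPointOfConductor_one_galoisConj N W K)
    (hD36 : ∀ (N : ℕ) [NeZero N] (W : WeierstrassCurve ℚ) (K : Type) [Field K] [NumberField K],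
      phi_heegnerTau_mem_singularModuliField N W K)
    (hJs : thm61_splitMultiplicative) (hJn : thm61_nonsplitMultiplicative)
    (hGS : ∀ (W : WeierstrassCurve ℚ) [W.IsElliptic] [W.IsGloballyMinimal] (p : ℕ) [Fact p.Prime],
      greenberg_stevens (W := W) (p := p))
    (hChaL : Cha2005.rmk25_pow_dvd_card_sha_primary_of_certificate)
    (hChaU : Cha2005.rmk25_padicValNat_card_sha_primary_add_le_of_globalDivisibility)
    (h₄ : Summit.BirchSwinnertonDyer.BirchSwinnertonDyer.Theses.ErratumRoadFive.X11aLowerHalf)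
    (hZ : ∀ (W : WeierstrassCurve ℚ) [W.IsElliptic] [W.IsGloballyMinimal] (p : ℕ) [Fact p.Prime]
      (N : ℕ) [NeZero N] (K : Type) [Field K] [NumberField K]
      (Dt : ModularParametrizationData W N) (β : ℤ) (ι : K →+* ℂ),
      ClassX11b W p → ¬ Surj W p → (p = 5 ∨ p = 7) → p ∣ padicValInt p W.minimalDiscriminantInt →
      ¬ Ram W p → W.conductorNorm ℤ = N → IsImaginaryQuadratic K →
      4 < (NumberField.discr K).natAbs → SatisfiesHeegnerHypothesis N K →
      SatisfiesHeegnerHypothesis p K → (4 * (N : ℤ)) ∣ β ^ 2 - NumberField.discr K → ¬ (p : ℤ) ∣ Dt.c →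
      ∃ M : ℕ, M ≤ padicValNat p W.tamagawaProduct ∧ CertificateAt Dt β ι p M)
    (hJ : ∀ (W : WeierstrassCurve ℚ) [W.IsElliptic] [W.IsGloballyMinimal] [NeZero (W.conductorNorm ℤ)]
      (p : ℕ) [Fact p.Prime] (K : Type) [Field K] [NumberField K]
      (Dt : ModularParametrizationData W (W.conductorNorm ℤ)) (β : ℤ) (ι : K →+* ℂ),
      ClassX11b W p → ¬ Surj W p → (p = 5 ∨ p = 7) → p ∣ padicValInt p W.minimalDiscriminantInt →
      ¬ Ram W p → IsImaginaryQuadratic K → 4 < (NumberField.discr K).natAbs →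
      SatisfiesHeegnerHypothesis (W.conductorNorm ℤ) K → SatisfiesHeegnerHypothesis p K →
      (4 * (W.conductorNorm ℤ : ℤ)) ∣ β ^ 2 - NumberField.discr K → ¬ (p : ℤ) ∣ Dt.c →
      ∀ (s : ℕ), s ≤ padicValNat p W.tamagawaProduct →
        ∀ (n : ℕ) (d : KolyvaginHeegnerData Dt β ι n), Squarefree n →
          (∀ ℓ ∈ n.primeFactors, Zhang2014.IsKolyvaginPrime (W.conductorNorm ℤ) W K p ℓ ∧
            s ≤ Zhang2014.kolyvaginIndex W p ℓ) → PDiv d p s)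
    (hMC : ∀ (Wd : WeierstrassCurve ℚ) [Wd.IsElliptic] [Wd.IsGloballyMinimal] (p : ℕ) [Fact p.Prime],
      ClassX11a Wd p → ¬ Surj Wd p → (p = 5 ∨ p = 7) →
      p ∣ padicValInt p Wd.minimalDiscriminantInt → X2.MazurMainConjectureAt Wd p) :
    Summit.BirchSwinnertonDyer.BirchSwinnertonDyer.Theses.ErratumRoadFive.NonSurjCorner :=
  erratumRoadFive_nonSurjCorner_of_refinedKolyvagin_of_lowerX11a_of_twinMultDivisibility hGZ hKo hWu hGZK
    hmod hnf hpar hFHs hMaz hrec hD36 hJs hJn hGS hChaL hChaU h₄ hZ hJ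
    (fun Wd _ _ p _ hXa hnsd h57 hvd ↦
      multDivisibilityAt_of_mazurMainConjectureAt Wd p (hMC Wd p hXa hnsd h57 hvd))

end Summit.BirchSwinnertonDyer.Rank1Residual.X11b

end
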